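import Summits.BirchSwinnertonDyer.Rank1Residual.O5.O5TransferCertificate
import HarnessLib

/-!
# The reciprocity bit is linear algebra + the sum formula (o5-r2 GEN 15, RECIP3 post-hoc reading) — PROVED, abstract

PLACEMENT (typer of record cc-typer-5 GEN 16; o5-r2 GEN 15 ask A-O5-G15-4, HOME/INBOX.md 2026-08-22T14:59:43Z l.12366 / update
15:03:45Z l.12384; DOCKETED by cc-lead ⟦gen64⟧ (2′) as (c27d)): (A) source FROZEN `HOME/b2b-bsdres-o5-r2/gen15/lean/ReciprocityBitLinearAlgebra.lean`
sha16 `304fb51334ee6e92` (350 l., 10 theorems; freeze of record = cc-lead GEN 64's re-hash, re-hashed by the typer right before writing =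
MATCH; `lean check` rc 0 / 0 warnings / 0 sorries re-run by the typer); (B) ALL decl blocks byte-identical (statements AND proofs; 0 proof
repairs) — typer edits = this paragraph only; imports `…O5.O5TransferCertificate` + `HarnessLib` only; namespace `…O5.SelmerTransfer`
(the tree's own `selmerOf loc X` framework of `O5/O5TransferCertificate.lean` §1); (E) THEOREMS ONLY — `@[conjecture]` 0, definitions 0,
sorry 0, 0 Literature facts, net named-fact debt 0.  (D) FRAMING: abstract linear algebra over a field `F` + ONE displayed global hypothesis
(the SUM FORMULA); nothing is asserted about curves; the arithmetic statements it skeletonises (RECIP3's `SecondReciprocityShadowThree` /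
`TwoPrimeSelmerBitThree` in `O5/SecondReciprocityThree.lean`, (c27b); R1♯ at k = 1) stay EVIDENCE-labelled THEOREM-CANDIDATES there;
census RECIP3 (kit j164932; census-lead l.12333 / l.12344 'RECIP3 SURVIVES on this census (EVIDENCE; 13 623 registered instances)')
= EVIDENCE, never a Literature fact; nothing is imported into a class row by this landing.  LANE CLASS-CLOSURE: research route; nothing
booked; no mark of `RESIDUAL-MAP.md` moves; O5 OPEN.

HONEST FRAMING: theorems only (no `@[conjecture]`, no Literature fact, nothing asserted about curves).  This is the
abstract skeleton of `gen15/RECIP3-DERIVATION.md` §2–§3 in the tree's own `SelmerTransfer.selmerOf` framework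
(`O5TransferCertificate.lean` §1): a global space `H` with localisations `loc v : H → L v`, bilinear local pairings
`b v`, and the ONE global input — the SUM FORMULA `∑ v, b v (loc v x) (loc v y) = 0` for all global `x, y` (Poitou–Tate /
reciprocity for the cup product, restricted to a finite set of places outside which both classes pair trivially).  Local
conditions `X v` isotropic for `b v`; at two places `q₁ ≠ q₂` a second ("transverse") condition `T i` such that a non-zero
transverse vector pairs non-degenerately with `X (q i)`.  CONCLUSION (`reciprocityBit`): for `κ₁` with conditions
`X` off `q₁` and `T₁` at `q₁` (non-zero there) and `κ₂` symmetric, `loc q₂ κ₁ = 0 ↔ loc q₁ κ₂ = 0` — the Mordell–Weil shadow of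
the second reciprocity law (census RECIP3: 11 078 + 517 instances, 0 off-diagonal) is forced by duality.  `locNeZero_of_not_mem`
is Lemma A (the transverse component of a class outside `Sel_X` is non-zero); `twoPrimeSelmerBit` is the two-prime Selmer
bit (RECIP3 cell R-2); `selmerOf_swap_eq_inf_ker_of_exists` / `selmerOf_swap_trichotomy` are the ONE-place swap (first
reciprocity / the Gross–Parson switch: the `k = 1` skeleton of R1♯ — lowering is exact with no parity input, and parity only
excludes the "both strict" case; `signedSwap_finrank` adds the parity input as a hypothesis and concludes the signed
dimension law `dim Sel_Y = dim Sel_X ∓ 1`).  Instantiation (not done here; it needs the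
Galois-cohomological objects): `H = H¹(ℚ_S/ℚ, C[3])`, `L v = H¹(ℚ_v, C[3])`, `b v` = local Tate pairing, `X v` = Kummer
conditions of `C`, `T i` = Kummer condition of the split Tate curve `G_i` at `q_i`.
-/

open Module

namespace Summit.BirchSwinnertonDyer.Rank1Residual.O5

namespace SelmerTransfer

variable {F : Type*} [Field F] {ι : Type*} {H : Type*} [AddCommGroup H] [Module F H]
  {L : ι → Type*} [∀ v, AddCommGroup (L v)] [∀ v, Module F (L v)]

/-- **Lemma A (abstract).**  If `κ` satisfies the conditions `X v` at every `v ≠ q` and is NOT in `Sel_X`, then its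
localisation at `q` is non-zero. [folklore] -/
theorem locNeZero_of_not_mem (loc : ∀ v, H →ₗ[F] L v) (X : ∀ v, Submodule F (L v)) (q : ι) (κ : H)
    (hoff : ∀ v, v ≠ q → loc v κ ∈ X v) (hnot : κ ∉ selmerOf loc X) : loc q κ ≠ 0 := by
  intro h0
  apply hnot
  rw [mem_selmerOf_iff]
  intro v
  by_cases hv : v = q
  · subst hv; rw [h0]; exact (X v).zero_mem
  · exact hoff v hv

/-- **The reciprocity bit (abstract second reciprocity law, vanishing level).**  Places `ι` (finite: the instantiation
restricts the Poitou–Tate sum to a finite set outside which both classes pair trivially), global space `H`,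
localisations `loc`, bilinear local pairings `b v`, the SUM FORMULA `hsum`, isotropic common conditions `X v`, and at
`q₁ ≠ q₂` transverse conditions `T₁, T₂` pairing non-degenerately with `X`: a non-zero transverse vector kills no non-zero
vector of `X` (`hperf₁`, `hperf₂`; for the local Tate pairing this is "`F` and `T` are complementary Lagrangians").
Then for `κ₁` (conditions `X` off `q₁`, transverse and non-zero at `q₁`) and `κ₂` (symmetric):
`loc q₂ κ₁ = 0 ↔ loc q₁ κ₂ = 0`. [folklore] -/
theorem reciprocityBit [Fintype ι] [DecidableEq ι]
    (loc : ∀ v, H →ₗ[F] L v) (b : ∀ v, L v →ₗ[F] L v →ₗ[F] F)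
    (hsum : ∀ x y : H, ∑ v, b v (loc v x) (loc v y) = 0)
    (X : ∀ v, Submodule F (L v)) (hX : ∀ v, ∀ a ∈ X v, ∀ c ∈ X v, b v a c = 0)
    {q₁ q₂ : ι} (hq : q₁ ≠ q₂) (T₁ : Submodule F (L q₁)) (T₂ : Submodule F (L q₂))
    (hperf₁ : ∀ t ∈ T₁, t ≠ 0 → ∀ f ∈ X q₁, b q₁ t f = 0 → f = 0)
    (hperf₂ : ∀ t ∈ T₂, t ≠ 0 → ∀ f ∈ X q₂, b q₂ f t = 0 → f = 0)
    {κ₁ κ₂ : H}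
    (h₁ : ∀ v, v ≠ q₁ → loc v κ₁ ∈ X v) (h₁T : loc q₁ κ₁ ∈ T₁) (h₁nz : loc q₁ κ₁ ≠ 0)
    (h₂ : ∀ v, v ≠ q₂ → loc v κ₂ ∈ X v) (h₂T : loc q₂ κ₂ ∈ T₂) (h₂nz : loc q₂ κ₂ ≠ 0) :
    loc q₂ κ₁ = 0 ↔ loc q₁ κ₂ = 0 := by
  -- the sum formula for (κ₁, κ₂), with every term off {q₁, q₂} vanishing by isotropy of X
  have hterm : ∀ v, v ≠ q₁ → v ≠ q₂ → b v (loc v κ₁) (loc v κ₂) = 0 :=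
    fun v hv₁ hv₂ => hX v _ (h₁ v hv₁) _ (h₂ v hv₂)
  have hsplit : ∑ v, b v (loc v κ₁) (loc v κ₂) =
      b q₁ (loc q₁ κ₁) (loc q₁ κ₂) + b q₂ (loc q₂ κ₁) (loc q₂ κ₂) := by
    rw [← Finset.sum_subset (Finset.subset_univ ({q₁, q₂} : Finset ι))]
    · rw [Finset.sum_pair hq]
    · intro v _ hv
      rw [Finset.mem_insert, Finset.mem_singleton, not_or] at hv
      exact hterm v hv.1 hv.2
  have hkey : b q₁ (loc q₁ κ₁) (loc q₁ κ₂) + b q₂ (loc q₂ κ₁) (loc q₂ κ₂) = 0 := by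
    rw [← hsplit]; exact hsum κ₁ κ₂
  have hf₁ : loc q₁ κ₂ ∈ X q₁ := h₂ q₁ hq
  have hf₂ : loc q₂ κ₁ ∈ X q₂ := h₁ q₂ (Ne.symm hq)
  constructor
  · intro h0
    -- the q₂-term vanishes, hence so does the q₁-term; perfectness at q₁ kills loc q₁ κ₂
    have ht₂ : b q₂ (loc q₂ κ₁) (loc q₂ κ₂) = 0 := by rw [h0, LinearMap.map_zero, LinearMap.zero_apply]
    have ht₁ : b q₁ (loc q₁ κ₁) (loc q₁ κ₂) = 0 := by rw [ht₂, add_zero] at hkey; exact hkey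
    exact hperf₁ _ h₁T h₁nz _ hf₁ ht₁
  · intro h0
    have ht₁ : b q₁ (loc q₁ κ₁) (loc q₁ κ₂) = 0 := by rw [h0, LinearMap.map_zero]
    have ht₂ : b q₂ (loc q₂ κ₁) (loc q₂ κ₂) = 0 := by rw [ht₁, zero_add] at hkey; exact hkey
    exact hperf₂ _ h₂T h₂nz _ hf₂ ht₂

/-- **The reciprocity bit for Selmer classes** (the shape RECIP3 instantiates): with `Y₁ := X` updated to `T₁` at `q₁`
and `Y₂ := X` updated to `T₂` at `q₂`, any `κ₁ ∈ Sel_{Y₁} ∖ Sel_X` and `κ₂ ∈ Sel_{Y₂} ∖ Sel_X` satisfy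
`loc q₂ κ₁ = 0 ↔ loc q₁ κ₂ = 0`.  (For `Sel_X = 0` — rank `0`, `Ш(C)[3] = 0` — "`∉ Sel_X`" is just "`≠ 0`".) [folklore] -/
theorem reciprocityBit_of_mem_selmerOf [Fintype ι] [DecidableEq ι]
    (loc : ∀ v, H →ₗ[F] L v) (b : ∀ v, L v →ₗ[F] L v →ₗ[F] F)
    (hsum : ∀ x y : H, ∑ v, b v (loc v x) (loc v y) = 0)
    (X : ∀ v, Submodule F (L v)) (hX : ∀ v, ∀ a ∈ X v, ∀ c ∈ X v, b v a c = 0)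
    {q₁ q₂ : ι} (hq : q₁ ≠ q₂) (T₁ : Submodule F (L q₁)) (T₂ : Submodule F (L q₂))
    (hperf₁ : ∀ t ∈ T₁, t ≠ 0 → ∀ f ∈ X q₁, b q₁ t f = 0 → f = 0)
    (hperf₂ : ∀ t ∈ T₂, t ≠ 0 → ∀ f ∈ X q₂, b q₂ f t = 0 → f = 0)
    {κ₁ κ₂ : H}
    (hκ₁ : κ₁ ∈ selmerOf loc (Function.update X q₁ T₁)) (hκ₁X : κ₁ ∉ selmerOf loc X)
    (hκ₂ : κ₂ ∈ selmerOf loc (Function.update X q₂ T₂)) (hκ₂X : κ₂ ∉ selmerOf loc X) :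
    loc q₂ κ₁ = 0 ↔ loc q₁ κ₂ = 0 := by
  rw [mem_selmerOf_iff] at hκ₁ hκ₂
  have h₁ : ∀ v, v ≠ q₁ → loc v κ₁ ∈ X v := by
    intro v hv; have := hκ₁ v; rwa [Function.update_of_ne hv] at this
  have h₂ : ∀ v, v ≠ q₂ → loc v κ₂ ∈ X v := by
    intro v hv; have := hκ₂ v; rwa [Function.update_of_ne hv] at this
  have h₁T : loc q₁ κ₁ ∈ T₁ := by have := hκ₁ q₁; rwa [Function.update_self] at this
  have h₂T : loc q₂ κ₂ ∈ T₂ := by have := hκ₂ q₂; rwa [Function.update_self] at this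
  exact reciprocityBit loc b hsum X hX hq T₁ T₂ hperf₁ hperf₂ h₁ h₁T
    (locNeZero_of_not_mem loc X q₁ κ₁ h₁ hκ₁X) h₂ h₂T (locNeZero_of_not_mem loc X q₂ κ₂ h₂ hκ₂X)


/-- **The two-prime Selmer bit (abstract form of RECIP3 cell R-2 / `TwoPrimeSelmerBitThree`).**  In the situation of
`reciprocityBit`, assume moreover that the transverse conditions meet `X` trivially (`hT₁`, `hT₂`) and that every class
with `X`-conditions off `{q₁, q₂}` and NO condition at `q₁, q₂` is a combination of `κ₁, κ₂` (`hspan`: the relaxed Selmer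
group is `⟨κ₁, κ₂⟩` — in the arithmetic instantiation this is the Greenberg–Wiles count for `Sel_X = 0`).  Let `Y` be `X`
with `T₁` at `q₁` and `T₂` at `q₂` (the conditions of the double level raising).  Then: if the bit is `1`
(`loc q₂ κ₁ = 0`) the Selmer group `Sel_Y` is all of `⟨κ₁, κ₂⟩`; if the bit is `0` it is zero. [folklore] -/
theorem twoPrimeSelmerBit [Fintype ι] [DecidableEq ι]
    (loc : ∀ v, H →ₗ[F] L v) (b : ∀ v, L v →ₗ[F] L v →ₗ[F] F)
    (hsum : ∀ x y : H, ∑ v, b v (loc v x) (loc v y) = 0)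
    (X : ∀ v, Submodule F (L v)) (hX : ∀ v, ∀ a ∈ X v, ∀ c ∈ X v, b v a c = 0)
    {q₁ q₂ : ι} (hq : q₁ ≠ q₂) (T₁ : Submodule F (L q₁)) (T₂ : Submodule F (L q₂))
    (hperf₁ : ∀ t ∈ T₁, t ≠ 0 → ∀ f ∈ X q₁, b q₁ t f = 0 → f = 0)
    (hperf₂ : ∀ t ∈ T₂, t ≠ 0 → ∀ f ∈ X q₂, b q₂ f t = 0 → f = 0)
    (hT₁ : ∀ t ∈ T₁, t ∈ X q₁ → t = 0) (hT₂ : ∀ t ∈ T₂, t ∈ X q₂ → t = 0)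
    {κ₁ κ₂ : H}
    (h₁ : ∀ v, v ≠ q₁ → loc v κ₁ ∈ X v) (h₁T : loc q₁ κ₁ ∈ T₁) (h₁nz : loc q₁ κ₁ ≠ 0)
    (h₂ : ∀ v, v ≠ q₂ → loc v κ₂ ∈ X v) (h₂T : loc q₂ κ₂ ∈ T₂) (h₂nz : loc q₂ κ₂ ≠ 0)
    (hspan : ∀ x : H, (∀ v, v ≠ q₁ → v ≠ q₂ → loc v x ∈ X v) → ∃ u w : F, u • κ₁ + w • κ₂ = x)
    (Y : ∀ v, Submodule F (L v)) (hYoff : ∀ v, v ≠ q₁ → v ≠ q₂ → Y v = X v) (hY₁ : Y q₁ = T₁) (hY₂ : Y q₂ = T₂) :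
    (loc q₂ κ₁ = 0 → ∀ x : H, x ∈ selmerOf loc Y ↔ ∃ u w : F, u • κ₁ + w • κ₂ = x) ∧
    (loc q₂ κ₁ ≠ 0 → selmerOf loc Y = ⊥) := by
  have hbit := reciprocityBit loc b hsum X hX hq T₁ T₂ hperf₁ hperf₂ h₁ h₁T h₁nz h₂ h₂T h₂nz
  have hf₁ : loc q₁ κ₂ ∈ X q₁ := h₂ q₁ hq
  have hf₂ : loc q₂ κ₁ ∈ X q₂ := h₁ q₂ (Ne.symm hq)
  -- a Y-Selmer class has X-conditions off {q₁, q₂}, hence is a combination of κ₁, κ₂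
  have hcomb : ∀ x : H, x ∈ selmerOf loc Y → ∃ u w : F, u • κ₁ + w • κ₂ = x := by
    intro x hx
    rw [mem_selmerOf_iff] at hx
    refine hspan x fun v hv₁ hv₂ => ?_
    rw [← hYoff v hv₁ hv₂]; exact hx v
  constructor
  · intro h0 x
    have h0' : loc q₁ κ₂ = 0 := hbit.mp h0
    refine ⟨hcomb x, ?_⟩
    rintro ⟨u, w, rfl⟩
    rw [mem_selmerOf_iff]
    intro v
    rw [map_add, map_smul, map_smul]
    by_cases hv₁ : v = q₁
    · subst hv₁
      rw [hY₁, h0', smul_zero, add_zero]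
      exact T₁.smul_mem u h₁T
    · by_cases hv₂ : v = q₂
      · subst hv₂
        rw [hY₂, h0, smul_zero, zero_add]
        exact T₂.smul_mem w h₂T
      · rw [hYoff v hv₁ hv₂]
        exact (X v).add_mem ((X v).smul_mem u (h₁ v hv₁)) ((X v).smul_mem w (h₂ v hv₂))
  · intro h0
    have h0' : loc q₁ κ₂ ≠ 0 := fun h => h0 (hbit.mpr h)
    rw [eq_bot_iff]
    intro x hx
    rw [Submodule.mem_bot]
    obtain ⟨u, w, rfl⟩ := hcomb x hx
    rw [mem_selmerOf_iff] at hx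
    -- at q₁: u•loc κ₁ + w•loc κ₂ ∈ T₁ with u•loc κ₁ ∈ T₁ forces w•loc κ₂ ∈ T₁ ∩ X q₁ = 0, so w = 0
    have hq₁ := hx q₁
    rw [hY₁, map_add, map_smul, map_smul] at hq₁
    have hw : w • loc q₁ κ₂ ∈ T₁ := by
      have := T₁.sub_mem hq₁ (T₁.smul_mem u h₁T)
      rwa [add_sub_cancel_left] at this
    have hw0 : w = 0 := by
      have hz := hT₁ _ hw ((X q₁).smul_mem w hf₁)
      rcases smul_eq_zero.mp hz with h | h
      · exact h
      · exact absurd h h0'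
    have hq₂ := hx q₂
    rw [hY₂, map_add, map_smul, map_smul] at hq₂
    have hu : u • loc q₂ κ₁ ∈ T₂ := by
      have := T₂.sub_mem hq₂ (T₂.smul_mem w h₂T)
      rwa [add_sub_cancel_right] at this
    have hu0 : u = 0 := by
      have hz := hT₂ _ hu ((X q₂).smul_mem u hf₂)
      rcases smul_eq_zero.mp hz with h | h
      · exact h
      · exact absurd h h0
    rw [hu0, hw0, zero_smul, zero_smul, add_zero]


/-- `selmerOf` is monotone in the local conditions. [folklore] -/
theorem selmerOf_mono (loc : ∀ v, H →ₗ[F] L v) {X Y : ∀ v, Submodule F (L v)} (h : ∀ v, X v ≤ Y v) :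
    selmerOf loc X ≤ selmerOf loc Y := by
  intro c hc
  rw [mem_selmerOf_iff] at hc ⊢
  exact fun v => h v (hc v)

/-- **One-place swap, lowering case (abstract first reciprocity / Gross–Parson switch).**  `X` and `Y` agree off `q`;
at `q`, `Y q = T` and a non-zero vector of `X q` kills no non-zero vector of `T` under `b q` (`hperf`).  If SOME `X`-Selmer
class is non-zero at `q`, then `Sel_Y` is exactly the strict part of `Sel_X`: `Sel_Y = Sel_X ∩ ker (loc q)`.  (With the sum
formula; this is the `d < k` branch of R1♯ at `k = 1` and needs NO parity input.) [folklore] -/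
theorem selmerOf_swap_eq_inf_ker_of_exists [Fintype ι] [DecidableEq ι]
    (loc : ∀ v, H →ₗ[F] L v) (b : ∀ v, L v →ₗ[F] L v →ₗ[F] F)
    (hsum : ∀ x y : H, ∑ v, b v (loc v x) (loc v y) = 0)
    (X : ∀ v, Submodule F (L v)) (hX : ∀ v, ∀ a ∈ X v, ∀ c ∈ X v, b v a c = 0)
    (q : ι) (T : Submodule F (L q)) (hperf : ∀ f ∈ X q, f ≠ 0 → ∀ t ∈ T, b q f t = 0 → t = 0)
    (Y : ∀ v, Submodule F (L v)) (hYoff : ∀ v, v ≠ q → Y v = X v) (hYq : Y q = T)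
    (hx : ∃ x ∈ selmerOf loc X, loc q x ≠ 0) :
    selmerOf loc Y = selmerOf loc X ⊓ LinearMap.ker (loc q) := by
  obtain ⟨x, hxX, hxq⟩ := hx
  rw [mem_selmerOf_iff] at hxX
  ext y
  rw [Submodule.mem_inf, LinearMap.mem_ker, mem_selmerOf_iff, mem_selmerOf_iff]
  constructor
  · intro hy
    -- pair x with y: every term off q vanishes, so b q (loc q x) (loc q y) = 0, and loc q y ∈ T dies
    have hsplit : ∑ v, b v (loc v x) (loc v y) = b q (loc q x) (loc q y) := by
      rw [← Finset.sum_subset (Finset.subset_univ ({q} : Finset ι))]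
      · rw [Finset.sum_singleton]
      · intro v _ hv
        rw [Finset.mem_singleton] at hv
        have hyv := hy v
        rw [hYoff v hv] at hyv
        exact hX v _ (hxX v) _ hyv
    have hyq : loc q y ∈ T := by have := hy q; rwa [hYq] at this
    have h0 : loc q y = 0 := hperf _ (hxX q) hxq _ hyq (by rw [← hsplit]; exact hsum x y)
    refine ⟨fun v => ?_, h0⟩
    by_cases hv : v = q
    · subst hv; rw [h0]; exact (X v).zero_mem
    · have := hy v; rwa [hYoff v hv] at this
  · rintro ⟨hyX, h0⟩ v
    by_cases hv : v = q
    · subst hv; rw [h0]; exact (Y v).zero_mem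
    · rw [hYoff v hv]; exact hyX v

/-- **One-place swap, the trichotomy.**  Under the sum formula, with `X`, `Y` agreeing off `q`, `X q` and `Y q` both
isotropic and non-degenerately paired (each non-zero vector of one kills no non-zero vector of the other), exactly one of
three things happens: `Sel_Y = Sel_X ∩ ker loc_q` (some `X`-class non-zero at `q`), `Sel_X = Sel_Y ∩ ker loc_q` (some
`Y`-class non-zero at `q`), or `Sel_X = Sel_Y` (everything strict at `q`).  Parity (`dim Sel_X`, `dim Sel_Y` of opposite
parity — the Cassels–Tate input, NOT assumed here) excludes the third case in the level-raising situation. [folklore] -/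
theorem selmerOf_swap_trichotomy [Fintype ι] [DecidableEq ι]
    (loc : ∀ v, H →ₗ[F] L v) (b : ∀ v, L v →ₗ[F] L v →ₗ[F] F)
    (hsum : ∀ x y : H, ∑ v, b v (loc v x) (loc v y) = 0)
    (X Y : ∀ v, Submodule F (L v)) (q : ι) (hYoff : ∀ v, v ≠ q → Y v = X v)
    (hX : ∀ v, ∀ a ∈ X v, ∀ c ∈ X v, b v a c = 0) (hYq_iso : ∀ a ∈ Y q, ∀ c ∈ Y q, b q a c = 0)
    (hperfXY : ∀ f ∈ X q, f ≠ 0 → ∀ t ∈ Y q, b q f t = 0 → t = 0)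
    (hperfYX : ∀ t ∈ Y q, t ≠ 0 → ∀ f ∈ X q, b q t f = 0 → f = 0) :
    ((∃ x ∈ selmerOf loc X, loc q x ≠ 0) ∧ selmerOf loc Y = selmerOf loc X ⊓ LinearMap.ker (loc q)) ∨
    ((∃ y ∈ selmerOf loc Y, loc q y ≠ 0) ∧ selmerOf loc X = selmerOf loc Y ⊓ LinearMap.ker (loc q)) ∨
    ((∀ x ∈ selmerOf loc X, loc q x = 0) ∧ (∀ y ∈ selmerOf loc Y, loc q y = 0) ∧ selmerOf loc X = selmerOf loc Y) := by
  by_cases hx : ∃ x ∈ selmerOf loc X, loc q x ≠ 0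
  · exact Or.inl ⟨hx, selmerOf_swap_eq_inf_ker_of_exists loc b hsum X hX q (Y q) hperfXY Y hYoff rfl hx⟩
  · push Not at hx
    by_cases hy : ∃ y ∈ selmerOf loc Y, loc q y ≠ 0
    · -- the symmetric swap: Y is the base, X the swapped condition (Y is isotropic everywhere too)
      have hYiso : ∀ v, ∀ a ∈ Y v, ∀ c ∈ Y v, b v a c = 0 := by
        intro v a ha c hc
        by_cases hv : v = q
        · subst hv; exact hYq_iso a ha c hc
        · rw [hYoff v hv] at ha hc; exact hX v a ha c hc
      refine Or.inr (Or.inl ⟨hy, ?_⟩)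
      exact selmerOf_swap_eq_inf_ker_of_exists loc b hsum Y hYiso q (X q) hperfYX X
        (fun v hv => (hYoff v hv).symm) rfl hy
    · push Not at hy
      refine Or.inr (Or.inr ⟨hx, hy, ?_⟩)
      ext z
      rw [mem_selmerOf_iff, mem_selmerOf_iff]
      constructor
      · intro hz v
        by_cases hv : v = q
        · subst hv; rw [hx z ((mem_selmerOf_iff loc X z).mpr hz)]; exact (Y v).zero_mem
        · rw [hYoff v hv]; exact hz v
      · intro hz v
        by_cases hv : v = q
        · subst hv; rw [hy z ((mem_selmerOf_iff loc Y z).mpr hz)]; exact (X v).zero_mem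
        · rw [← hYoff v hv]; exact hz v


/-- Rank–nullity for a localisation restricted to a subspace: `dim S = dim (S ∩ ker f) + dim f(S)`. [folklore] -/
theorem finrank_eq_finrank_inf_ker_add_finrank_range {W : Type*} [AddCommGroup W] [Module F W]
    (S : Submodule F H) (f : H →ₗ[F] W) [FiniteDimensional F S] :
    finrank F S = finrank F ↥(S ⊓ LinearMap.ker f) + finrank F (LinearMap.range (f.domRestrict S)) := by
  have h := LinearMap.finrank_range_add_finrank_ker (f.domRestrict S)
  have hk : LinearMap.ker (f.domRestrict S) = (S ⊓ LinearMap.ker f).comap S.subtype := by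
    show LinearMap.ker (f.comp S.subtype) = _
    rw [LinearMap.ker_comp, Submodule.comap_inf, Submodule.comap_subtype_self, top_inf_eq]
  rw [hk, (Submodule.comapSubtypeEquivOfLe (inf_le_left : S ⊓ LinearMap.ker f ≤ S)).finrank_eq] at h
  omega

/-- If a subspace `S` localises into a line `X q` (`dim ≤ 1`) and some element of `S` is non-zero at `q`, then the strict
part `S ∩ ker loc_q` has codimension exactly `1`. [folklore] -/
theorem finrank_inf_ker_add_one {W : Type*} [AddCommGroup W] [Module F W] [FiniteDimensional F W]
    (S : Submodule F H) (f : H →ₗ[F] W) [FiniteDimensional F S] (Xq : Submodule F W) (hXq : finrank F Xq ≤ 1)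
    (hS : ∀ x ∈ S, f x ∈ Xq) (hx : ∃ x ∈ S, f x ≠ 0) :
    finrank F ↥(S ⊓ LinearMap.ker f) + 1 = finrank F S := by
  have h := finrank_eq_finrank_inf_ker_add_finrank_range (F := F) S f
  have hle : LinearMap.range (f.domRestrict S) ≤ Xq := by
    rintro _ ⟨x, rfl⟩
    exact hS x x.2
  have h1 : finrank F (LinearMap.range (f.domRestrict S)) ≤ 1 := (Submodule.finrank_mono hle).trans hXq
  have h2 : finrank F (LinearMap.range (f.domRestrict S)) ≠ 0 := by
    intro h0
    rw [Submodule.finrank_eq_zero, LinearMap.range_eq_bot] at h0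
    obtain ⟨x, hxS, hxq⟩ := hx
    apply hxq
    have := LinearMap.congr_fun h0 ⟨x, hxS⟩
    simpa using this
  omega

/-- **The signed one-prime transfer, abstract (k = 1 skeleton of T-O5-JP / R1♯).**  Sum formula; `X`, `Y` agree off `q`;
`X q`, `Y q` isotropic LINES (`dim ≤ 1`) non-degenerately paired; and the PARITY INPUT `dim Sel_X ≢ dim Sel_Y (mod 2)`
(Cassels–Tate + root numbers in the arithmetic instantiation — assumed here, not proved).  Then:
some `X`-Selmer class non-zero at `q` ⟹ `dim Sel_Y = dim Sel_X − 1`; every `X`-Selmer class zero at `q` ⟹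
`dim Sel_Y = dim Sel_X + 1`. [folklore] -/
theorem signedSwap_finrank [Fintype ι] [DecidableEq ι] [FiniteDimensional F H] [∀ v, FiniteDimensional F (L v)]
    (loc : ∀ v, H →ₗ[F] L v) (b : ∀ v, L v →ₗ[F] L v →ₗ[F] F)
    (hsum : ∀ x y : H, ∑ v, b v (loc v x) (loc v y) = 0)
    (X Y : ∀ v, Submodule F (L v)) (q : ι) (hYoff : ∀ v, v ≠ q → Y v = X v)
    (hX : ∀ v, ∀ a ∈ X v, ∀ c ∈ X v, b v a c = 0) (hYq_iso : ∀ a ∈ Y q, ∀ c ∈ Y q, b q a c = 0)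
    (hperfXY : ∀ f ∈ X q, f ≠ 0 → ∀ t ∈ Y q, b q f t = 0 → t = 0)
    (hperfYX : ∀ t ∈ Y q, t ≠ 0 → ∀ f ∈ X q, b q t f = 0 → f = 0)
    (hXq : finrank F (X q) ≤ 1) (hYq : finrank F (Y q) ≤ 1)
    (hpar : finrank F (selmerOf loc X) % 2 ≠ finrank F (selmerOf loc Y) % 2) :
    ((∃ x ∈ selmerOf loc X, loc q x ≠ 0) → finrank F (selmerOf loc Y) + 1 = finrank F (selmerOf loc X)) ∧
    ((∀ x ∈ selmerOf loc X, loc q x = 0) → finrank F (selmerOf loc Y) = finrank F (selmerOf loc X) + 1) := by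
  have hSX : ∀ x ∈ selmerOf loc X, loc q x ∈ X q := fun x hx => (mem_selmerOf_iff loc X x).mp hx q
  have hSY : ∀ y ∈ selmerOf loc Y, loc q y ∈ Y q := fun y hy => (mem_selmerOf_iff loc Y y).mp hy q
  rcases selmerOf_swap_trichotomy loc b hsum X Y q hYoff hX hYq_iso hperfXY hperfYX with
    ⟨hx, hEq⟩ | ⟨hy, hEq⟩ | ⟨hx0, _, hEq⟩
  · -- lowering: Sel_Y = Sel_X ∩ ker loc_q, codimension 1
    have hdim : finrank F (selmerOf loc Y) + 1 = finrank F (selmerOf loc X) := by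
      rw [hEq]; exact finrank_inf_ker_add_one (selmerOf loc X) (loc q) (X q) hXq hSX hx
    refine ⟨fun _ => hdim, fun hall => ?_⟩
    obtain ⟨x, hxX, hxq⟩ := hx
    exact absurd (hall x hxX) hxq
  · -- raising: Sel_X = Sel_Y ∩ ker loc_q, codimension 1 in Sel_Y
    have hdim : finrank F (selmerOf loc X) + 1 = finrank F (selmerOf loc Y) := by
      rw [hEq]; exact finrank_inf_ker_add_one (selmerOf loc Y) (loc q) (Y q) hYq hSY hy
    refine ⟨fun hx => ?_, fun _ => hdim.symm⟩
    obtain ⟨x, hxX, hxq⟩ := hx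
    rw [hEq, Submodule.mem_inf, LinearMap.mem_ker] at hxX
    exact absurd hxX.2 hxq
  · -- both strict: Sel_X = Sel_Y, excluded by parity
    exact absurd (by rw [hEq]) hpar

end SelmerTransfer

end Summit.BirchSwinnertonDyer.Rank1Residual.O5
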